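import Mathlib
import Summits.NavierStokesRegularity.NavierStokesRegularity.Theorems.TaoLadderRungTwoFlatCoreApriori
import Summits.NavierStokesRegularity.NavierStokesRegularity.Theorems.TaoLadderRungTwoFlatComovingPulse
import Summits.NavierStokesRegularity.NavierStokesRegularity.Theorems.TaoLadderRungTwoFlatCoMovingEnergyEdge
import Summits.NavierStokesRegularity.NavierStokesRegularity.Theorems.TaoLadderRungTwoFlatInterfaceStencil
import Summits.NavierStokesRegularity.NavierStokesRegularity.Theorems.TaoLadderRungTwoFlatJunkAmplitude
import Summits.NavierStokesRegularity.NavierStokesRegularity.Theorems.TaoLadderRungTwoFlatBootstrap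
import HarnessLib

/-!
# The JOINT per-hop a-priori package by continuous induction (flat dynamics, scale 1): near energy and core deviation
  stay in their basins during the hop (helper for the K_A♭ parent item stmt-NavierStokesRegularity-22987
  `FlatGapCertificatesV2`, children 1A/2A of route TaoLadderRungTwoFlat; cell harvest/h2-tao-ladder, p1 g22; LADDER §49.5,
  HopTube `TubeStepCore` + `TubeStepNear` jointly)

THE LOOP AT EACH INSTANT OF A HOP, and how it closes. Along two global solutions of the flat mirror lattice `T♭(ε)` — the
hop flow `X` and the pulse `Φ` (scale `1`), `u = X − Φ` — with the CORE above the edge shell `e` (truncated deviation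
`truncFam e u`, gauge `geomGauge g b`), the NEAR block `[a, e+1]` (co-moving energy, edge `n_e(t) = e + 1 + σt`,
`σt ≤ 1` during the hop) and a finite pulse window `W ⊆ [e+3, ∞)`:
(ii) `core_apriori_flat` — the core gauge deviation on `[0, t]` is `≤ (B + F t)e^{Lt}` with `F` linear in the near edge
amplitude `q̄` and in the core interface deviation `r̄` (small factors: the pulse tail `η_blk`, `ε`);
(i) `abs_le_of_energy_budget` — sup-closeness `R⋆/ω_W` to `Φ` on `W` and the partial-energy bound `2E` of `X` bound every
site outside `W` by `A_JB = √(2E − (max 0 (√E_W − (R⋆/ω_W)√(2|W|)))²)`, so `|u| ≤ A := A_JB + η_blk` around the block;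
(iii) `coMovingEnergyOn_decay_of_globalSol` + `edgeInput_le` — with that `A`, a rate `0 < μ ≤ σθ − 2(1+ε)(A sinh(θ/2) +
η_blk(3+e^θ))` and the core deviation `r₁ ≥ R⋆/ω_{0,e+2}` above the block, `V(t) ≤ V(0) + Ē(A, η_blk, r₁)/μ`.
Every link is continuous in `t`; `…Theorems.Bootstrap.Icc_induction₂` closes the loop:

* `hop_apriori_flat` — under the CLOSING CONDITIONS (`R⋆ ≤ ω_{0,e+1} b₂` for the core at the levels `q̄(a₁) =
  √(2e^{2θ}a₁)`, `r̄ = a₂`; `V₀ + Ē/μ ≤ b₁` for the near zone; `b₁ < a₁`, `b₂ < a₂`; start inside `b₁`, `b₂`), for every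
  `t ∈ [0, τ₁]`: `V(t) ≤ b₁` and `|u_{0,e+1}(t)| ≤ b₂`. These are exactly the a-priori inputs (`A`, `M = η_blk`, `r`) of
  `HopTube.near_hop_of_globalSols` / `near_hop_of_pseudoFlows_amp` and the history inputs (`q̄`, `r̄`) of the core landing
  estimate `MirrorPulse.truncated_hop_estimate_anchored` — the per-hop instantiation of `TubeStepCore n` + `TubeStepNear n`
  for the flat tube no longer has free a-priori hypotheses, only schedule inequalities.

HONEST FRAMING: a conditional finite-time estimate about a MODEL lattice (Tao 2016 §4 vocabulary on `S♭`, flat clocks);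
every constant is a HYPOTHESIS tied by explicit inequalities; nothing certified; nothing about the Navier–Stokes equations.
-/

noncomputable section

-- the sub-problem namespace repeats the summit name by design (D-0017)
set_option linter.dupNamespace false

namespace Summit.NavierStokesRegularity.NavierStokesRegularity.Theorems

open Set Filter Literature.Analysis.FluidPDE Literature.Analysis.FluidPDE.TaoCascade QuadPolar
open scoped Topology

namespace MirrorPulse

/-- Monotonicity of the junk bound in the reference window energy: a LARGER window energy `E' ≥ E_W` of the reference
gives a SMALLER outside amplitude. [folklore; route TaoLadderRungTwoFlat, (JB) ⇒ junk amplitude (LADDER §49.4)] -/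
theorem junkBound_mono {E EW E' c : ℝ} (hEW : EW ≤ E') :
    Real.sqrt (2 * E - (max 0 (Real.sqrt E' - c)) ^ 2) ≤ Real.sqrt (2 * E - (max 0 (Real.sqrt EW - c)) ^ 2) := by
  apply Real.sqrt_le_sqrt
  have h1 : max 0 (Real.sqrt EW - c) ≤ max 0 (Real.sqrt E' - c) :=
    max_le_max le_rfl (sub_le_sub_right (Real.sqrt_le_sqrt hEW) c)
  have h2 : (max 0 (Real.sqrt EW - c)) ^ 2 ≤ (max 0 (Real.sqrt E' - c)) ^ 2 :=
    pow_le_pow_left₀ (le_max_left _ _) h1 2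
  linarith

/-- **THE JOINT PER-HOP A-PRIORI PACKAGE (flat, scale 1), by continuous induction.** See the module docstring for the
loop; hypotheses in order: the two global solutions with a common sup bound `M` and the partial-energy bound `2E` of `X`;
the geometry (`a ≤ e`, window `W` above `e+3`); gauge and clock parameters (`σ τ₁ ≤ 1`); the pulse tail `η_blk` on the
block neighbourhood `[a−1, e+2]` and its window energy `≥ E_W` during the hop; the initial core gauge datum `B` and near
energy `V₀`; the bootstrap levels `b₁ < a₁`, `b₂ < a₂` and the closing conditions.
[cite: Tao2016AveragedNS, §4 Lemma 4.1 (4.3), (4.8), §6.3–6.4 (statement shape: a-priori control during one checkpoint step); route TaoLadderRungTwoFlat, LADDER §49.5 (the two-zone loop within a hop), HopTube `TubeStepCore`+`TubeStepNear`] -/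
theorem hop_apriori_flat {ε : ℝ} {Φ X : Fin 2 → ℤ → ℝ → ℝ} (hΦ : IsGlobalSol ε Φ) (hX : IsGlobalSol ε X)
    (hε : 0 ≤ ε) {M E : ℝ} (hΦb : ∀ i n t, |Φ i n t| ≤ M) (hXb : ∀ i n t, |X i n t| ≤ M)
    (hEn : ∀ (t : ℝ) (S : Finset ℤ), ∑ n ∈ S, ∑ i : Fin 2, X i n t ^ 2 ≤ 2 * E)
    {a e : ℤ} (hae : a ≤ e) (W : Finset ℤ) (hW : ∀ n ∈ W, e + 3 ≤ n)
    {g b θ σ τ₁ : ℝ} (hg : 1 ≤ g) (hb : 1 ≤ b) (hθ : 0 ≤ θ) (hτ₁ : 0 ≤ τ₁) (hσ : 0 ≤ σ) (hστ : σ * τ₁ ≤ 1)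
    {ηblk : ℝ} (hηblk0 : 0 ≤ ηblk)
    (hΦblk : ∀ i, ∀ n ∈ Finset.Icc (a - 1) (e + 2), ∀ t ∈ Icc 0 τ₁, |Φ i n t| ≤ ηblk)
    {EW : ℝ} (hEW : ∀ t ∈ Icc 0 τ₁, EW ≤ ∑ n ∈ W, ∑ i : Fin 2, Φ i n t ^ 2)
    {B V₀ : ℝ} (hB : ∀ i k, geomGauge g b i k * |truncFam e (X - Φ) i k 0| ≤ B)
    (hV₀ : coMovingEnergyOn (Finset.Icc a (e + 1)) θ ((e : ℝ) + 1) (X - Φ) 0 ≤ V₀)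
    {a₁ b₁ a₂ b₂ ωW Rstar A r₁ μ : ℝ} (hab₁ : b₁ < a₁) (hab₂ : b₂ < a₂)
    (hV₀b : V₀ ≤ b₁) (hr0b : |(X - Φ) 0 (e + 1) 0| ≤ b₂)
    (hωW0 : 0 < ωW) (hωW : ∀ i, ∀ n ∈ W, ωW ≤ geomGauge g b i n)
    (hRstar : (B + (geomGauge g b 0 (e + 1) * (Real.sqrt (2 * Real.exp (2 * θ) * a₁) *
                  (2 * ηblk + Real.sqrt (2 * Real.exp (2 * θ) * a₁) + ε * (ηblk + a₂)))
              + geomGauge g b 1 e * (a₂ * (ηblk + ε * (2 * ηblk + a₂)))) * τ₁)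
            * Real.exp (2 * tableAbsSum shiftSetFlat (mirrorTable ε ε) * M * max g b * τ₁) ≤ Rstar)
    (hC2 : Rstar ≤ geomGauge g b 0 (e + 1) * b₂)
    (hr₁ : Rstar ≤ geomGauge g b 0 (e + 2) * r₁) (hr₁A : r₁ ≤ A)
    (hAJB : Real.sqrt (2 * E - (max 0 (Real.sqrt EW - Rstar / ωW * Real.sqrt (2 * (W.card : ℝ)))) ^ 2)
              + ηblk ≤ A)
    (hμ : 0 < μ) (hμle : μ ≤ σ * θ - 2 * (1 + ε) * 1 * (A * Real.sinh (θ / 2) + ηblk * (3 + Real.exp θ)))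
    (hC1 : V₀ + (Real.exp (θ * ((a : ℝ) - ((e : ℝ) + 1))) * ((1 + ε) * 1 * A ^ 2 * (A + ηblk))
                  + (1 + ε) * 1 * r₁ * (A ^ 2 + ηblk * r₁)) / μ ≤ b₁) :
    ∀ t ∈ Icc 0 τ₁,
      coMovingEnergyOn (Finset.Icc a (e + 1)) θ ((e : ℝ) + 1 + σ * t) (X - Φ) t ≤ b₁ ∧
        |(X - Φ) 0 (e + 1) t| ≤ b₂ := by
  -- elementary monotonicity of the Grönwall majorant `(B + F s)e^{L s}` in `s`
  have hmono : ∀ {B' F' L' s' τ' : ℝ}, 0 ≤ B' → 0 ≤ F' → 0 ≤ L' → 0 ≤ s' → s' ≤ τ' →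
      (B' + F' * s') * Real.exp (L' * s') ≤ (B' + F' * τ') * Real.exp (L' * τ') := by
    intro B' F' L' s' τ' hB' hF' hL' hs' hsτ
    have h1 : B' + F' * s' ≤ B' + F' * τ' := by linarith [mul_le_mul_of_nonneg_left hsτ hF']
    have h2 : Real.exp (L' * s') ≤ Real.exp (L' * τ') := Real.exp_le_exp.mpr (mul_le_mul_of_nonneg_left hsτ hL')
    have h3 : 0 ≤ B' + F' * τ' := by nlinarith
    exact mul_le_mul h1 h2 (Real.exp_pos _).le h3
  -- signs and elementary facts
  have hωpos : ∀ j n, 0 < geomGauge g b j n := fun j n => geomGauge_pos (by linarith) (by linarith) j n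
  have hb₂0 : 0 ≤ b₂ := (abs_nonneg _).trans hr0b
  have ha₂0 : 0 ≤ a₂ := hb₂0.trans hab₂.le
  have hV00 : 0 ≤ coMovingEnergyOn (Finset.Icc a (e + 1)) θ ((e : ℝ) + 1) (X - Φ) 0 :=
    coMovingEnergyOn_nonneg _ _ _ _ _
  have hV₀0 : 0 ≤ V₀ := hV00.trans hV₀
  have hb₁0 : 0 ≤ b₁ := hV₀0.trans hV₀b
  have ha₁0 : 0 ≤ a₁ := hb₁0.trans hab₁.le
  have hqbar0 : 0 ≤ Real.sqrt (2 * Real.exp (2 * θ) * a₁) := Real.sqrt_nonneg _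
  have hB0 : 0 ≤ B := le_trans (mul_nonneg (hωpos 0 0).le (abs_nonneg _)) (hB 0 0)
  have hF0 : 0 ≤ geomGauge g b 0 (e + 1) * (Real.sqrt (2 * Real.exp (2 * θ) * a₁) *
        (2 * ηblk + Real.sqrt (2 * Real.exp (2 * θ) * a₁) + ε * (ηblk + a₂)))
      + geomGauge g b 1 e * (a₂ * (ηblk + ε * (2 * ηblk + a₂))) := by
    have h1 := (hωpos 0 (e + 1)).le
    have h2 := (hωpos 1 e).le
    positivity
  have hM0 : 0 ≤ M := (abs_nonneg _).trans (hΦb 0 0 0)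
  have hL0 : 0 ≤ 2 * tableAbsSum shiftSetFlat (mirrorTable ε ε) * M * max g b := by
    have := tableAbsSum_nonneg shiftSetFlat (mirrorTable ε ε)
    have : 0 ≤ max g b := le_trans (by linarith) (le_max_left g b)
    positivity
  have hRstar0 : 0 ≤ Rstar := by
    refine le_trans ?_ hRstar
    exact mul_nonneg (by positivity) (Real.exp_pos _).le
  have hr₁0 : 0 ≤ r₁ := by
    by_contra hneg
    rw [not_le] at hneg
    have : geomGauge g b 0 (e + 2) * r₁ < 0 := mul_neg_of_pos_of_neg (hωpos 0 (e + 2)) hneg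
    linarith
  have hA0 : 0 ≤ A := hr₁0.trans hr₁A
  have hEbar0 : 0 ≤ Real.exp (θ * ((a : ℝ) - ((e : ℝ) + 1))) * ((1 + ε) * 1 * A ^ 2 * (A + ηblk))
      + (1 + ε) * 1 * r₁ * (A ^ 2 + ηblk * r₁) := by positivity
  -- continuity of the two quantities
  have huc : ∀ j n, Continuous ((X - Φ) j n) := fun j n => by
    have h : Continuous fun t => X j n t - Φ j n t := (hX.continuous j n).sub (hΦ.continuous j n)
    have e1 : (X - Φ) j n = fun t => X j n t - Φ j n t := by funext t; simp
    rw [e1]; exact h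
  have hVc : ContinuousOn (fun t => coMovingEnergyOn (Finset.Icc a (e + 1)) θ ((e : ℝ) + 1 + σ * t) (X - Φ) t)
      (Icc 0 τ₁) :=
    continuousOn_coMovingEnergyOn (θ := θ) (σ := σ) (n₀ := (e : ℝ) + 1) (t₁ := 0) (t₂ := τ₁)
      (Finset.Icc a (e + 1)) (u := X - Φ) (fun i n _ => (huc i n).continuousOn)
  have hrc : ContinuousOn (fun t => |(X - Φ) 0 (e + 1) t|) (Icc 0 τ₁) := ((huc 0 (e + 1)).abs).continuousOn
  have hV0' : (fun t => coMovingEnergyOn (Finset.Icc a (e + 1)) θ ((e : ℝ) + 1 + σ * t) (X - Φ) t) 0 ≤ b₁ := by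
    have e0 : (e : ℝ) + 1 + σ * 0 = (e : ℝ) + 1 := by ring
    simp only [e0]
    exact hV₀.trans hV₀b
  -- THE STEP of the continuous induction
  have hstep : ∀ t ∈ Icc 0 τ₁,
      (∀ s ∈ Icc 0 t, (fun t => coMovingEnergyOn (Finset.Icc a (e + 1)) θ ((e : ℝ) + 1 + σ * t) (X - Φ) t) s ≤ a₁ ∧
        (fun t => |(X - Φ) 0 (e + 1) t|) s ≤ a₂) →
      (fun t => coMovingEnergyOn (Finset.Icc a (e + 1)) θ ((e : ℝ) + 1 + σ * t) (X - Φ) t) t ≤ b₁ ∧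
        (fun t => |(X - Φ) 0 (e + 1) t|) t ≤ b₂ := by
    intro t ht hpast
    simp only [] at hpast ⊢
    have ht0 : 0 ≤ t := ht.1
    have htτ : t ≤ τ₁ := ht.2
    -- (a) the near edge amplitude on [0, t]
    have hedge : e ∈ Finset.Icc a (e + 1) := by rw [Finset.mem_Icc]; exact ⟨hae, by omega⟩
    have hq : ∀ s ∈ Icc 0 t, |(X - Φ) 1 e s| ≤ Real.sqrt (2 * Real.exp (2 * θ) * a₁) := by
      intro s hs
      have hVs := (hpast s hs).1
      have h1 := abs_behind_le_of_coMovingEnergyOn (Finset.Icc a (e + 1)) θ ((e : ℝ) + 1 + σ * s) (X - Φ) s hedge 1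
      refine h1.trans (Real.sqrt_le_sqrt ?_)
      have hσs : σ * s ≤ 1 := le_trans (mul_le_mul_of_nonneg_left (hs.2.trans htτ) hσ) hστ
      have hw : Real.exp (θ * ((e : ℝ) + 1 + σ * s - (e : ℝ))) ≤ Real.exp (2 * θ) := by
        have hθσ : θ * (σ * s) ≤ θ * 1 := mul_le_mul_of_nonneg_left hσs hθ
        exact Real.exp_le_exp.mpr (by linarith)
      have hVs0 : 0 ≤ coMovingEnergyOn (Finset.Icc a (e + 1)) θ ((e : ℝ) + 1 + σ * s) (X - Φ) s :=
        coMovingEnergyOn_nonneg _ _ _ _ _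
      have := mul_le_mul hw hVs hVs0 (Real.exp_pos _).le
      linarith
    -- (b) the core gauge deviation on [0, t]
    have hrs : ∀ s ∈ Icc 0 t, |(X - Φ) 0 (e + 1) s| ≤ a₂ := fun s hs => (hpast s hs).2
    have hΦe : ∀ s ∈ Icc 0 t, |Φ 1 e s| ≤ ηblk := fun s hs =>
      hΦblk 1 e (by rw [Finset.mem_Icc]; omega) s ⟨hs.1, hs.2.trans htτ⟩
    have hΦe1 : ∀ s ∈ Icc 0 t, |Φ 0 (e + 1) s| ≤ ηblk := fun s hs =>
      hΦblk 0 (e + 1) (by rw [Finset.mem_Icc]; omega) s ⟨hs.1, hs.2.trans htτ⟩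
    have hcore : ∀ (i : Fin 2) (k : ℤ), ∀ s ∈ Icc 0 t,
        geomGauge g b i k * |truncFam e (X - Φ) i k s| ≤ Rstar := by
      intro i k s hs
      have h := core_apriori_flat (T := t) hΦ hX hε hΦb hXb hg hb hB hΦe hΦe1 hηblk0 hq hqbar0 hrs ha₂0 i k hs
      exact h.trans ((hmono hB0 hF0 hL0 hs.1 (hs.2.trans htτ)).trans hRstar)
    -- (c) the core conjunct at time t
    have hrt : |(X - Φ) 0 (e + 1) t| ≤ b₂ := by
      have h := hcore 0 (e + 1) t ⟨ht0, le_rfl⟩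
      rw [truncFam_of_le le_rfl] at h
      exact le_of_mul_le_mul_left (h.trans hC2) (hωpos 0 (e + 1))
    -- (d) sup-closeness on the pulse window and the junk amplitude outside it, on [0, t]
    have hdevW : ∀ s ∈ Icc 0 t, ∀ i, ∀ n ∈ W, |X i n s - Φ i n s| ≤ Rstar / ωW := by
      intro s hs i n hn
      have hk : e + 1 ≤ n := by have := hW n hn; omega
      have h := hcore i n s hs
      rw [truncFam_of_le hk] at h
      rw [le_div_iff₀ hωW0]
      have e1 : (X - Φ) i n s = X i n s - Φ i n s := by simp
      calc |X i n s - Φ i n s| * ωW = ωW * |(X - Φ) i n s| := by rw [e1]; ring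
        _ ≤ geomGauge g b i n * |(X - Φ) i n s| := mul_le_mul_of_nonneg_right (hωW i n hn) (abs_nonneg _)
        _ ≤ Rstar := h
    have hamp : ∀ s ∈ Icc 0 t, ∀ i, ∀ n ∈ Finset.Icc (a - 1) (e + 2), |(X - Φ) i n s| ≤ A := by
      intro s hs i n hn
      have hnW : n ∉ W := by
        intro hnW
        have := hW n hnW
        rw [Finset.mem_Icc] at hn
        omega
      have hδ0 : 0 ≤ Rstar / ωW := div_nonneg hRstar0 hωW0.le
      have hX' := abs_le_of_energy_budget (z := fun i n => X i n s) (φ := fun i n => Φ i n s) W (hEn s) hδ0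
        (hdevW s hs) hnW i
      have hXA : |X i n s|
          ≤ Real.sqrt (2 * E - (max 0 (Real.sqrt EW - Rstar / ωW * Real.sqrt (2 * (W.card : ℝ)))) ^ 2) :=
        hX'.trans (junkBound_mono (hEW s ⟨hs.1, hs.2.trans htτ⟩))
      have hΦA : |Φ i n s| ≤ ηblk := hΦblk i n hn s ⟨hs.1, hs.2.trans htτ⟩
      have htri : |(X - Φ) i n s| ≤ |X i n s| + |Φ i n s| := by
        have e1 : (X - Φ) i n s = X i n s - Φ i n s := by simp
        rw [e1]; exact abs_sub _ _
      linarith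
    -- (e) the near conjunct at time t: decay on [0, t]
    have hVt : coMovingEnergyOn (Finset.Icc a (e + 1)) θ ((e : ℝ) + 1 + σ * t) (X - Φ) t ≤ b₁ := by
      have haP : a ≤ e + 1 := by omega
      have hA' : ∀ s ∈ Ioo 0 t, ∀ i, ∀ n ∈ Finset.Icc (a - 1) (e + 1 + 1), |(X - Φ) i n s| ≤ A := by
        intro s hs i n hn
        have e2 : e + 1 + 1 = e + 2 := by ring
        rw [e2] at hn
        exact hamp s ⟨hs.1.le, hs.2.le⟩ i n hn
      have hM' : ∀ s ∈ Ioo 0 t, ∀ i, ∀ n ∈ Finset.Icc (a - 1) (e + 1 + 1), |Φ i n s| ≤ ηblk := by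
        intro s hs i n hn
        have e2 : e + 1 + 1 = e + 2 := by ring
        rw [e2] at hn
        exact hΦblk i n hn s ⟨hs.1.le, hs.2.le.trans htτ⟩
      have hE' : ∀ s ∈ Ioo 0 t,
          Real.exp (θ * ((a : ℝ) - ((e : ℝ) + 1 + σ * s))) * |fluxT ε 0 (X - Φ) (a - 1) s|
            + Real.exp (θ * ((((e + 1 : ℤ)) : ℝ) - ((e : ℝ) + 1 + σ * s))) * |fluxT ε 0 (X - Φ) (e + 1) s|
            + (1 + ε) * 1 * ηblk *
              (Real.exp (θ * ((a : ℝ) - ((e : ℝ) + 1 + σ * s))) * (X - Φ) 1 (a - 1) s ^ 2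
                + Real.exp (θ * ((((e + 1 : ℤ)) : ℝ) - ((e : ℝ) + 1 + σ * s))) * (X - Φ) 0 (e + 1 + 1) s ^ 2)
            ≤ Real.exp (θ * ((a : ℝ) - ((e : ℝ) + 1))) * ((1 + ε) * 1 * A ^ 2 * (A + ηblk))
              + (1 + ε) * 1 * r₁ * (A ^ 2 + ηblk * r₁) := by
        intro s hs
        have hs' : s ∈ Icc 0 t := ⟨hs.1.le, hs.2.le⟩
        have hσs : 0 ≤ σ * s := mul_nonneg hσ hs.1.le
        have hqa : |(X - Φ) 1 (a - 1) s| ≤ A := hamp s hs' 1 (a - 1) (by rw [Finset.mem_Icc]; omega)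
        have hpa : |(X - Φ) 0 a s| ≤ A := hamp s hs' 0 a (by rw [Finset.mem_Icc]; omega)
        have hqP : |(X - Φ) 1 (e + 1) s| ≤ A := hamp s hs' 1 (e + 1) (by rw [Finset.mem_Icc]; omega)
        have hrr : |(X - Φ) 0 (e + 1 + 1) s| ≤ r₁ := by
          have e2 : e + 1 + 1 = e + 2 := by ring
          have h := hcore 0 (e + 2) s hs'
          rw [truncFam_of_le (by omega)] at h
          rw [e2]
          exact le_of_mul_le_mul_left (h.trans hr₁) (hωpos 0 (e + 2))
        have hPne : (((e + 1 : ℤ)) : ℝ) ≤ (e : ℝ) + 1 + σ * s := by push_cast; linarith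
        have hc1 : ∀ n : ℤ, clock 0 n ≤ 1 := fun n => by unfold clock; simp
        have hedge := edgeInput_le (θ := θ) (ne := (e : ℝ) + 1 + σ * s) hε (by norm_num) hθ hηblk0 (X - Φ) s
          hPne hqa hpa hqP hrr hr₁A (hc1 _) (hc1 _)
        refine hedge.trans ?_
        have hX0 : 0 ≤ (1 + ε) * 1 * A ^ 2 * (A + ηblk) := by positivity
        have hw : Real.exp (θ * ((a : ℝ) - ((e : ℝ) + 1 + σ * s))) ≤ Real.exp (θ * ((a : ℝ) - ((e : ℝ) + 1))) :=
          Real.exp_le_exp.mpr (mul_le_mul_of_nonneg_left (by linarith [hσs]) hθ)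
        exact add_le_add_left (mul_le_mul_of_nonneg_right hw hX0) _
      have hdecay := coMovingEnergyOn_decay_of_globalSol (n₀ := (e : ℝ) + 1) (σ := σ) (θ := θ) hε hθ haP ht0
        hΦ hX hA' hM' hE' hμ hμle
      -- read the decay at time t
      have e0 : (e : ℝ) + 1 + σ * 0 = (e : ℝ) + 1 := by ring
      rw [e0, sub_zero] at hdecay
      have hexp1 : Real.exp (-μ * t) ≤ 1 := by
        have hμt : 0 ≤ μ * t := mul_nonneg hμ.le ht0
        exact Real.exp_le_one_iff.mpr (by linarith)
      have h1 : Real.exp (-μ * t) * coMovingEnergyOn (Finset.Icc a (e + 1)) θ ((e : ℝ) + 1) (X - Φ) 0 ≤ V₀ := by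
        calc Real.exp (-μ * t) * coMovingEnergyOn (Finset.Icc a (e + 1)) θ ((e : ℝ) + 1) (X - Φ) 0
            ≤ 1 * coMovingEnergyOn (Finset.Icc a (e + 1)) θ ((e : ℝ) + 1) (X - Φ) 0 :=
              mul_le_mul_of_nonneg_right hexp1 hV00
          _ ≤ V₀ := by rw [one_mul]; exact hV₀
      have h2 : (Real.exp (θ * ((a : ℝ) - ((e : ℝ) + 1))) * ((1 + ε) * 1 * A ^ 2 * (A + ηblk))
              + (1 + ε) * 1 * r₁ * (A ^ 2 + ηblk * r₁)) * (1 - Real.exp (-μ * t)) / μ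
          ≤ (Real.exp (θ * ((a : ℝ) - ((e : ℝ) + 1))) * ((1 + ε) * 1 * A ^ 2 * (A + ηblk))
              + (1 + ε) * 1 * r₁ * (A ^ 2 + ηblk * r₁)) / μ := by
        rw [div_le_div_iff_of_pos_right hμ]
        have hexp0 : 0 ≤ Real.exp (-μ * t) := (Real.exp_pos _).le
        have h3 := mul_le_mul_of_nonneg_left (show (1 - Real.exp (-μ * t)) ≤ 1 by linarith) hEbar0
        exact h3.trans_eq (mul_one _)
      exact hdecay.trans ((add_le_add h1 h2).trans hC1)
    exact ⟨hVt, hrt⟩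
  -- continuous induction
  exact Bootstrap.Icc_induction₂ hτ₁ hVc hrc hab₁ hab₂ hV0' hr0b hstep

end MirrorPulse

end Summit.NavierStokesRegularity.NavierStokesRegularity.Theorems

end
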